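import Mathlib.NumberTheory.ArithmeticFunction.Liouville
import Mathlib.NumberTheory.Harmonic.Bounds
import Mathlib.Analysis.SpecialFunctions.Pow.Asymptotics
import Literature.NumberTheory.LFunctions.MoebiusSumClassicalBound
import Literature.NumberTheory.LFunctions.PrimeNumberTheoremErrorTerm
import HarnessLib

/-!
# `∑_{n ≤ x} λ(n) ≪_A x (log x)^{-A}`: the prime number theorem for the Liouville function

Topic `Literature/NumberTheory/LFunctions` (trunk T-ANT). Everything in this file is PROVED.

The summatory function `L(x) = ∑_{n ≤ x} λ(n)` of Liouville's function (`λ(n) = (−1)^{Ω(n)}`,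
Mathlib's `ArithmeticFunction.liouville`) satisfies, for every real `A`,
`|L(x)| ≤ C_A x / (log x)^A` for all `x ≥ 2` (`Literature.NumberTheory.LFunctions.abs_sum_liouville_le_logPow`). This is the
input of Selberg's parity examples `1 ± λ(n)` (level of distribution `x^{1−ε}` of the integers
with an even / odd number of prime factors; Selberg 1949, Ford 2005 §1, Friedlander 2006 §1), see
`Literature/NumberTheory/Sieve/ParityBarrierSelbergProofs.lean`.

Proof (the route of Montgomery–Vaughan §6.2.1 Exercise 11 (c): "Use (6.17) and the fact that
`λ(n) = ∑_{d² ∣ n} μ(n/d²)` to give a second proof of" `∑_{n ≤ x} λ(n) ≪ x exp(−c√log x)`,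
read at PDF p. 145): from the tree's de la Vallée-Poussin–Landau bound (6.17) for the Möbius sum
`|M(x)| = |∑_{n ≤ x} μ(n)| ≤ C x exp(−c √log x)` (`Literature.NumberTheory.LFunctions.abs_sum_moebius_le_mul_exp_neg_sqrt_log`,
file `MoebiusSumClassicalBound.lean`, PROVED there from the classical zero-free region), first in
the form `|M(x)| ≤ C_A x/(log x)^A` (`Literature.NumberTheory.LFunctions.abs_sum_moebius_le_logPow`, via `Literature.NumberTheory.LFunctions.logPow_of_expSqrt`),
then through the Dirichlet identity `λ = 𝟙_□ ⋆ μ` (`𝟙_□ = ζ ⋆ λ` the indicator of the squares,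
`LiouvilleSum.zeta_mul_liouville_apply`), i.e. `L(x) = ∑_{a ≤ x, a = □} M(x/a)`
(`LiouvilleSum.sum_liouville_eq`):
the squares `a ≤ x^{3/4}` contribute `≪ x (log x)^{−A−1} ∑_{a} 1/a ≪ x (log x)^{−A}` and the
`≤ √x` squares `a > x^{3/4}` contribute at most `√x · x^{1/4} = x^{3/4}` by the trivial bound
`|M(y)| ≤ y`.

## References

* H. L. Montgomery, R. C. Vaughan, *Multiplicative Number Theory I*, CUP 2007, §6.2: (6.17)
  `M(x) ≪ x exp(−c√log x)` and §6.2.1 Exercise 11 (b)–(c) `∑_{n ≤ x} λ(n) ≪ x exp(−c√log x)`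
  (`lit read book:montgomery2007-multiplicative-number-theory-i-classical-theory --pages 145`)
  [MontgomeryVaughan2007].

## Mathlib / tree search

Mathlib (pinned) has `ArithmeticFunction.liouville` with `liouville_apply_mul`,
`isMultiplicative_liouville`, `cardFactors_apply_prime_pow`, the rearrangement
`ArithmeticFunction.sum_Ioc_mul_eq_sum_sum`, `coe_zeta_mul_coe_moebius`, `harmonic_le_one_add_log`,
`isLittleO_log_rpow_rpow_atTop`; no estimate for `∑ λ(n)` or `∑ μ(n)`. The tree has the Möbius
bound (above) and, inside the computational file `RHWave0Proofs.lean` (namespace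
`Literature.RH.PolyaCounterexample`, importing all of Mathlib and the Tanaka certificate), the divisor-sum
identity `∑_{d ∣ n} λ(d) = [n = □]` and the count of squares `≤ x`; the 40 lines proving these two
folklore facts are repeated here (namespace `Literature.LiouvilleSum`) to keep the import graph of the
sieve files light.
-/

noncomputable section

open Finset ArithmeticFunction Filter Asymptotics
open scoped ArithmeticFunction.Moebius ArithmeticFunction.zeta

namespace Literature.NumberTheory.LFunctions

/-! ### The Möbius sum: every power of `log` -/

/-- **`M(x) ≪_A x (log x)^{-A}`**: for every real `A` there is `C_A` with
`|∑_{n ≤ x} μ(n)| ≤ C_A x/(log x)^A` for all `x ≥ 2` (Montgomery–Vaughan §6.2 (6.17)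
`M(x) ≪ x exp(−c√log x)`, a fortiori every power of `log`; from the tree's de la Vallée-Poussin
form `Literature.NumberTheory.LFunctions.abs_sum_moebius_le_mul_exp_neg_sqrt_log` and `Literature.NumberTheory.LFunctions.logPow_of_expSqrt`).
[cite: MontgomeryVaughan2007, §6.2 (6.17)] -/
theorem abs_sum_moebius_le_logPow (A : ℝ) :
    ∃ C : ℝ, ∀ x : ℝ, 2 ≤ x → |∑ n ∈ Ioc 0 ⌊x⌋₊, (μ n : ℝ)| ≤ C * x / Real.log x ^ A := by
  obtain ⟨c, hc, C, hC⟩ := abs_sum_moebius_le_mul_exp_neg_sqrt_log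
  have h := logPow_of_expSqrt (f := fun x => (∑ n ∈ Ioc 0 ⌊x⌋₊, (μ n : ℝ)) + x) (c := c)
    (C := C) hc (fun x hx => by
      have h1 := hC x hx
      rw [neg_mul, Real.exp_neg, ← div_eq_mul_inv] at h1
      simpa only [add_sub_cancel_right] using h1) A
  simpa only [add_sub_cancel_right] using h

namespace LiouvilleSum

/-! ### `∑_{d ∣ n} λ(d) = [n is a square]` -/

/-- `λ(p^k) = (-1)^k`. [folklore] -/
theorem liouville_apply_prime_pow {p : ℕ} (hp : p.Prime) (k : ℕ) :
    liouville (p ^ k) = (-1) ^ k := by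
  rw [liouville_apply (pow_ne_zero k hp.ne_zero), cardFactors_apply_prime_pow hp]

/-- `∑_{i ≤ k} (-1)^i = [k even]` over `ℤ`. [folklore] -/
theorem sum_range_succ_neg_one_pow (k : ℕ) :
    ∑ i ∈ range (k + 1), (-1 : ℤ) ^ i = if Even k then 1 else 0 := by
  rw [neg_one_geom_sum]
  by_cases hk : Even k
  · simp [hk, Nat.even_add_one]
  · simp [hk, Nat.even_add_one]

/-- A natural number `n ≠ 0` is a square iff every exponent in its factorisation is even.
[folklore] -/
theorem isSquare_iff_even_factorization {n : ℕ} (hn : n ≠ 0) :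
    IsSquare n ↔ ∀ p ∈ n.primeFactors, Even (n.factorization p) := by
  constructor
  · rintro ⟨r, rfl⟩ p _
    have hr : r ≠ 0 := by rintro rfl; simp at hn
    rw [Nat.factorization_mul hr hr]
    simp
  · intro h
    refine ⟨n.factorization.prod fun p k => p ^ (k / 2), ?_⟩
    rw [← Finsupp.prod_mul]
    conv_lhs => rw [← Nat.prod_factorization_pow_eq_self hn]
    apply Finsupp.prod_congr
    intro p hp
    rw [← pow_add]
    congr 1
    have := h p (by simpa using hp)
    obtain ⟨t, ht⟩ := this
    omega

/-- `∑_{d ∣ n} λ(d) = [n is a square]` for `n ≠ 0`, i.e. `ζ ⋆ λ = 𝟙_□` (Liouville's function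
summed over divisors; multiplicativity and `1 − 1 + 1 − ⋯ ± 1`). [folklore] -/
theorem sum_divisors_liouville {n : ℕ} (hn : n ≠ 0) :
    ∑ d ∈ n.divisors, liouville d = if IsSquare n then 1 else 0 := by
  have hmul : IsMultiplicative ((zeta : ArithmeticFunction ℤ) * liouville) :=
    isMultiplicative_zeta.natCast.mul isMultiplicative_liouville
  rw [← coe_zeta_mul_apply, hmul.multiplicative_factorization _ hn]
  have hpp : ∀ p ∈ n.primeFactors,
      ((zeta : ArithmeticFunction ℤ) * liouville) (p ^ n.factorization p) =
        if Even (n.factorization p) then 1 else 0 := by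
    intro p hp
    have hp' : p.Prime := Nat.prime_of_mem_primeFactors hp
    rw [coe_zeta_mul_apply, Nat.sum_divisors_prime_pow hp']
    simp_rw [liouville_apply_prime_pow hp']
    exact sum_range_succ_neg_one_pow _
  rw [Finsupp.prod, Nat.support_factorization, prod_congr rfl hpp, prod_boole]
  by_cases hsq : IsSquare n
  · rw [if_pos hsq, if_pos ((isSquare_iff_even_factorization hn).mp hsq)]
  · rw [if_neg hsq, if_neg (mt (isSquare_iff_even_factorization hn).mpr hsq)]

/-- There are `⌊√x⌋` squares in `[1, x]`. [folklore] -/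
theorem card_filter_isSquare_Ioc (x : ℕ) :
    #{n ∈ Ioc 0 x | IsSquare n} = Nat.sqrt x := by
  have : {n ∈ Ioc 0 x | IsSquare n} = (Ioc 0 (Nat.sqrt x)).image fun m => m * m := by
    ext n
    simp only [mem_filter, mem_Ioc, mem_image]
    constructor
    · rintro ⟨⟨hn0, hnx⟩, r, rfl⟩
      refine ⟨r, ⟨Nat.pos_of_ne_zero ?_, Nat.le_sqrt.mpr hnx⟩, rfl⟩
      rintro rfl; simp at hn0
    · rintro ⟨m, ⟨hm0, hmx⟩, rfl⟩
      exact ⟨⟨Nat.mul_pos hm0 hm0, Nat.le_sqrt.mp hmx⟩, m, rfl⟩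
  rw [this, card_image_of_injective _ fun a b h => Nat.mul_self_inj.mp h, Nat.card_Ioc,
    Nat.sub_zero]

/-! ### `λ = 𝟙_□ ⋆ μ` and `L(x) = ∑_{a = □} M(x/a)` -/

/-- `(ζ ⋆ λ)(n) = [n is a square]` for `n ≠ 0`, for the real-valued arithmetic functions
(`sum_divisors_liouville` pushed through the casts). [folklore] -/
theorem zeta_mul_liouville_apply {n : ℕ} (hn : n ≠ 0) :
    ((ζ : ArithmeticFunction ℝ) * (liouville : ArithmeticFunction ℝ)) n =
      if IsSquare n then 1 else 0 := by
  rw [coe_zeta_mul_apply]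
  simp_rw [intCoe_apply]
  rw [← Int.cast_sum, sum_divisors_liouville hn]
  split_ifs <;> simp

/-- `λ = (ζ ⋆ λ) ⋆ μ = 𝟙_□ ⋆ μ` (use `ζ ⋆ μ = δ`). [folklore] -/
theorem coe_liouville_eq_zeta_mul_liouville_mul_moebius :
    (liouville : ArithmeticFunction ℝ) =
      (ζ : ArithmeticFunction ℝ) * (liouville : ArithmeticFunction ℝ) *
        (μ : ArithmeticFunction ℝ) := by
  rw [mul_right_comm, coe_zeta_mul_coe_moebius, one_mul]

/-- **`L(N) = ∑_{a ≤ N, a = □} M(⌊N/a⌋)`** (Dirichlet's rearrangement of `λ = 𝟙_□ ⋆ μ`;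
Mathlib's `ArithmeticFunction.sum_Ioc_mul_eq_sum_sum`), with the indicator of the squares written
as `if IsSquare a then 1 else 0`. [folklore] -/
theorem sum_liouville_eq (N : ℕ) :
    ∑ n ∈ Ioc 0 N, (liouville n : ℝ) =
      ∑ a ∈ Ioc 0 N, (if IsSquare a then (1 : ℝ) else 0) * ∑ m ∈ Ioc 0 (N / a), (μ m : ℝ) := by
  have h := sum_Ioc_mul_eq_sum_sum ((ζ : ArithmeticFunction ℝ) * (liouville : ArithmeticFunction ℝ))
    (μ : ArithmeticFunction ℝ) N
  rw [← coe_liouville_eq_zeta_mul_liouville_mul_moebius] at h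
  simp only [intCoe_apply] at h
  rw [h]
  exact sum_congr rfl fun a ha => by rw [zeta_mul_liouville_apply (mem_Ioc.mp ha).1.ne']

/-- `∑_{a ≤ N} [a = □] = ⌊√N⌋ ≤ √N`. [folklore] -/
theorem sum_Ioc_ite_isSquare_le (N : ℕ) :
    ∑ a ∈ Ioc 0 N, (if IsSquare a then (1 : ℝ) else 0) ≤ Real.sqrt N := by
  rw [sum_boole, card_filter_isSquare_Ioc]
  exact Real.nat_sqrt_le_real_sqrt

/-- `|λ(n)| ≤ 1` (as a real number; `λ(0) = 0`). [folklore] -/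
theorem abs_liouville_le_one (n : ℕ) : |(liouville n : ℝ)| ≤ 1 := by
  rcases eq_or_ne n 0 with rfl | hn
  · simp
  · rw [liouville_apply hn]
    push_cast
    rw [abs_pow, abs_neg, abs_one, one_pow]

/-- The trivial bound `|M(n)| ≤ n`. [folklore] -/
theorem abs_sum_moebius_le (n : ℕ) : |∑ m ∈ Ioc 0 n, (μ m : ℝ)| ≤ n :=
  calc |∑ m ∈ Ioc 0 n, (μ m : ℝ)| ≤ ∑ m ∈ Ioc 0 n, |(μ m : ℝ)| := abs_sum_le_sum_abs _ _
    _ ≤ ∑ m ∈ Ioc 0 n, (1 : ℝ) := sum_le_sum fun m _ => by exact_mod_cast abs_moebius_le_one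
    _ = n := by simp

/-- The trivial bound `|L(n)| ≤ n`. [folklore] -/
theorem abs_sum_liouville_le (n : ℕ) : |∑ m ∈ Ioc 0 n, (liouville m : ℝ)| ≤ n :=
  calc |∑ m ∈ Ioc 0 n, (liouville m : ℝ)|
      ≤ ∑ m ∈ Ioc 0 n, |(liouville m : ℝ)| := abs_sum_le_sum_abs _ _
    _ ≤ ∑ m ∈ Ioc 0 n, (1 : ℝ) := sum_le_sum fun m _ => abs_liouville_le_one m
    _ = n := by simp

/-! ### Elementary real-variable helpers -/

/-- `1 ≤ log x` for `x ≥ 3`. [folklore] -/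
theorem one_le_log {x : ℝ} (hx : 3 ≤ x) : 1 ≤ Real.log x := by
  rw [← Real.log_exp 1]
  exact Real.log_le_log (Real.exp_pos 1) (le_trans (le_of_lt (by
    have := Real.exp_one_lt_d9; linarith)) hx)

/-- `∑_{1 ≤ a ≤ n} 1/a ≤ 1 + log n` (Mathlib's `harmonic_le_one_add_log`, restated for a real sum
over `Ioc 0 n`). [folklore] -/
theorem sum_Ioc_inv_le_one_add_log (n : ℕ) :
    ∑ a ∈ Ioc 0 n, (a : ℝ)⁻¹ ≤ 1 + Real.log n := by
  have h := harmonic_le_one_add_log n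
  have hcast : ((harmonic n : ℚ) : ℝ) = ∑ a ∈ Ioc 0 n, (a : ℝ)⁻¹ := by
    rw [harmonic_eq_sum_Icc, show Icc 1 n = Ioc 0 n from Finset.Icc_add_one_left_eq_Ioc 0 n]
    push_cast
    rfl
  rwa [hcast] at h

/-- Patching an eventual bound `|g(x)| ≤ C x/(log x)^A` (`x ≥ X₀`) with the trivial bound
`|g(x)| ≤ x` on `[2, X₀]`: `(log x)^A` is monotone in `x`, hence bounded on `[2, X₀]`. [folklore] -/
theorem forall_two_le_of_forall_ge {g : ℝ → ℝ} (hg : ∀ x, 2 ≤ x → |g x| ≤ x) {A C X₀ : ℝ}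
    (h : ∀ x, X₀ ≤ x → |g x| ≤ C * x / Real.log x ^ A) :
    ∃ C' : ℝ, ∀ x, 2 ≤ x → |g x| ≤ C' * x / Real.log x ^ A := by
  set X₁ : ℝ := max X₀ 2 with hX₁
  set K : ℝ := Real.log 2 ^ A + Real.log X₁ ^ A with hK
  have hl2 : 0 < Real.log 2 := Real.log_pos one_lt_two
  have hX₁2 : 2 ≤ X₁ := le_max_right _ _
  have hlX₁ : 0 < Real.log X₁ := Real.log_pos (by linarith)
  have hK0 : 0 ≤ K := add_nonneg (Real.rpow_nonneg hl2.le A) (Real.rpow_nonneg hlX₁.le A)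
  refine ⟨max C 0 + K, fun x hx => ?_⟩
  have hx0 : 0 ≤ x := by linarith
  have hL0 : 0 < Real.log x := Real.log_pos (by linarith)
  have hLA : 0 < Real.log x ^ A := Real.rpow_pos_of_pos hL0 A
  rcases le_or_gt X₀ x with hxX | hxX
  · calc |g x| ≤ C * x / Real.log x ^ A := h x hxX
      _ ≤ (max C 0 + K) * x / Real.log x ^ A := by
          gcongr
          linarith [le_max_left C 0]
  · have hxX₁ : x ≤ X₁ := hxX.le.trans (le_max_left _ _)
    have hKx : Real.log x ^ A ≤ K := by
      rcases le_or_gt 0 A with hA | hA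
      · calc Real.log x ^ A ≤ Real.log X₁ ^ A :=
              Real.rpow_le_rpow hL0.le (Real.log_le_log (by linarith) hxX₁) hA
          _ ≤ K := le_add_of_nonneg_left (Real.rpow_nonneg hl2.le A)
      · calc Real.log x ^ A ≤ Real.log 2 ^ A :=
              Real.rpow_le_rpow_of_nonpos hl2 (Real.log_le_log two_pos hx) hA.le
          _ ≤ K := le_add_of_nonneg_right (Real.rpow_nonneg hlX₁.le A)
    calc |g x| ≤ x := hg x hx
      _ = Real.log x ^ A * x / Real.log x ^ A := by field_simp
      _ ≤ K * x / Real.log x ^ A := by gcongr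
      _ ≤ (max C 0 + K) * x / Real.log x ^ A := by
          gcongr
          linarith [le_max_right C 0]

/-! ### The estimate -/

/-- The core estimate for large `x` and `A ≥ 0`:
`|L(x)| ≤ (2 C 4^{A+1} + 1) x/(log x)^A` once `x ≥ 3`, `x^{1/4} ≥ 2` and `(log x)^A ≤ x^{1/4}`,
where `C = C_{A+1}` is the constant of `abs_sum_moebius_le_logPow (A + 1)`. [folklore] -/
theorem abs_sum_liouville_le_eventually {A : ℝ} (hA : 0 ≤ A) :
    ∃ C : ℝ, ∀ᶠ x : ℝ in atTop,
      |∑ n ∈ Ioc 0 ⌊x⌋₊, (liouville n : ℝ)| ≤ C * x / Real.log x ^ A := by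
  obtain ⟨C₁, hC₁⟩ := abs_sum_moebius_le_logPow (A + 1)
  set C : ℝ := max C₁ 0 with hCdef
  have hC0 : 0 ≤ C := le_max_right _ _
  have hA1 : 0 < A + 1 := by linarith
  refine ⟨2 * C * 4 ^ (A + 1) + 1, ?_⟩
  filter_upwards [eventually_ge_atTop (3 : ℝ),
    (tendsto_rpow_atTop (by norm_num : (0 : ℝ) < 1 / 4)).eventually_ge_atTop 2,
    (isLittleO_log_rpow_rpow_atTop A (by norm_num : (0 : ℝ) < 1 / 4)).eventuallyLE]
    with x hx3 hx4 hlog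
  -- unpack the hypotheses
  have hx0 : 0 < x := by linarith
  have hx1 : 1 ≤ x := by linarith
  have hL1 : 1 ≤ Real.log x := one_le_log hx3
  have hL0 : 0 < Real.log x := by linarith
  have hLA : 0 < Real.log x ^ A := Real.rpow_pos_of_pos hL0 A
  have hLA1 : Real.log x ^ (A + 1) = Real.log x ^ A * Real.log x := Real.rpow_add_one hL0.ne' A
  rw [Real.norm_eq_abs, Real.norm_eq_abs, abs_of_pos hLA,
    abs_of_pos (Real.rpow_pos_of_pos hx0 _)] at hlog
  -- `hlog : log x ^ A ≤ x ^ (1/4)`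
  have h34 : (0 : ℝ) ≤ x ^ (3 / 4 : ℝ) := Real.rpow_nonneg hx0.le _
  have hq14 : x / x ^ (3 / 4 : ℝ) = x ^ (1 / 4 : ℝ) := by
    rw [show (1 / 4 : ℝ) = 1 - 3 / 4 by norm_num, Real.rpow_sub hx0, Real.rpow_one]
  have hq34 : x / x ^ (1 / 4 : ℝ) = x ^ (3 / 4 : ℝ) := by
    rw [show (3 / 4 : ℝ) = 1 - 1 / 4 by norm_num, Real.rpow_sub hx0, Real.rpow_one]
  have hsqrt : x ^ (1 / 4 : ℝ) * Real.sqrt x = x ^ (3 / 4 : ℝ) := by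
    rw [Real.sqrt_eq_rpow, ← Real.rpow_add hx0]
    norm_num
  set N : ℕ := ⌊x⌋₊ with hN
  set A₀ : ℕ := ⌊x ^ (3 / 4 : ℝ)⌋₊ with hA₀
  have hNx : (N : ℝ) ≤ x := Nat.floor_le hx0.le
  have hA₀le : (A₀ : ℝ) ≤ x ^ (3 / 4 : ℝ) := Nat.floor_le h34
  have h34x : x ^ (3 / 4 : ℝ) ≤ x := by
    conv_rhs => rw [← Real.rpow_one x]
    exact Real.rpow_le_rpow_of_exponent_le hx1 (by norm_num)
  have hA₀N : A₀ ≤ N := Nat.floor_le_floor h34x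
  have hA₀1 : 1 ≤ A₀ := Nat.le_floor (by
    rw [Nat.cast_one]; exact Real.one_le_rpow hx1 (by norm_num))
  have hA₀pos : (0 : ℝ) < A₀ := by exact_mod_cast hA₀1
  -- the identity and the splitting at `A₀`
  rw [sum_liouville_eq N, ← sum_Ioc_consecutive _ (Nat.zero_le A₀) hA₀N]
  refine (abs_add_le _ _).trans ?_
  -- Part 1: `a ≤ A₀`
  set K : ℝ := C * 4 ^ (A + 1) / Real.log x ^ (A + 1) with hKdef
  have hK0 : 0 ≤ K := by positivity
  have hg0 : ∀ a : ℕ, (0 : ℝ) ≤ if IsSquare a then (1 : ℝ) else 0 := fun a => by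
    split_ifs <;> norm_num
  have hg1 : ∀ a : ℕ, (if IsSquare a then (1 : ℝ) else 0) ≤ 1 := fun a => by
    split_ifs <;> norm_num
  have hterm1 : ∀ a ∈ Ioc 0 A₀,
      |(if IsSquare a then (1 : ℝ) else 0) * ∑ m ∈ Ioc 0 (N / a), (μ m : ℝ)| ≤ K * (x / a) := by
    intro a ha
    obtain ⟨ha0, haA⟩ := mem_Ioc.mp ha
    have ha0' : (0 : ℝ) < a := by exact_mod_cast ha0
    have hax : (a : ℝ) ≤ x ^ (3 / 4 : ℝ) := le_trans (by exact_mod_cast haA) hA₀le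
    -- `x / a ≥ x^{1/4} ≥ 2`
    have hxa : x ^ (1 / 4 : ℝ) ≤ x / a := by
      rw [← hq14]
      exact div_le_div_of_nonneg_left hx0.le ha0' hax
    have hxa2 : 2 ≤ x / a := hx4.trans hxa
    have hM := hC₁ (x / a) hxa2
    rw [Nat.floor_div_natCast] at hM
    -- `log (x/a) ≥ (1/4) log x > 0`
    have hlxa : 1 / 4 * Real.log x ≤ Real.log (x / a) := by
      rw [← Real.log_rpow hx0]
      exact Real.log_le_log (Real.rpow_pos_of_pos hx0 _) hxa
    have hlxa0 : 0 < 1 / 4 * Real.log x := by positivity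
    have hpow : (1 / 4 * Real.log x) ^ (A + 1) ≤ Real.log (x / a) ^ (A + 1) :=
      Real.rpow_le_rpow hlxa0.le hlxa hA1.le
    have hpow' : (1 / 4 * Real.log x) ^ (A + 1) = (4 ^ (A + 1))⁻¹ * Real.log x ^ (A + 1) := by
      rw [Real.mul_rpow (by norm_num) hL0.le, show (1 / 4 : ℝ) = 4⁻¹ by norm_num,
        Real.inv_rpow (by norm_num)]
    have hpos1 : 0 < (1 / 4 * Real.log x) ^ (A + 1) := Real.rpow_pos_of_pos hlxa0 _
    calc |(if IsSquare a then (1 : ℝ) else 0) * ∑ m ∈ Ioc 0 (N / a), (μ m : ℝ)|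
        = (if IsSquare a then (1 : ℝ) else 0) * |∑ m ∈ Ioc 0 (N / a), (μ m : ℝ)| := by
          rw [abs_mul, abs_of_nonneg (hg0 a)]
      _ ≤ |∑ m ∈ Ioc 0 (N / a), (μ m : ℝ)| :=
          mul_le_of_le_one_left (abs_nonneg _) (hg1 a)
      _ ≤ C₁ * (x / a) / Real.log (x / a) ^ (A + 1) := hM
      _ ≤ C * (x / a) / Real.log (x / a) ^ (A + 1) := by
          gcongr
          · exact (hpos1.trans_le hpow).le
          · exact le_max_left _ _
      _ ≤ C * (x / a) / (1 / 4 * Real.log x) ^ (A + 1) := by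
          gcongr
      _ = K * (x / a) := by
          rw [hpow', hKdef]
          field_simp
  have h1 : |∑ a ∈ Ioc 0 A₀, (if IsSquare a then (1 : ℝ) else 0) * ∑ m ∈ Ioc 0 (N / a), (μ m : ℝ)| ≤
      2 * C * 4 ^ (A + 1) * x / Real.log x ^ A := by
    calc |∑ a ∈ Ioc 0 A₀, (if IsSquare a then (1 : ℝ) else 0) * ∑ m ∈ Ioc 0 (N / a), (μ m : ℝ)|
        ≤ ∑ a ∈ Ioc 0 A₀, |(if IsSquare a then (1 : ℝ) else 0) * ∑ m ∈ Ioc 0 (N / a), (μ m : ℝ)| :=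
          abs_sum_le_sum_abs _ _
      _ ≤ ∑ a ∈ Ioc 0 A₀, K * (x / a) := sum_le_sum hterm1
      _ = K * x * ∑ a ∈ Ioc 0 A₀, (a : ℝ)⁻¹ := by
          rw [mul_sum]
          refine sum_congr rfl fun a _ => ?_
          ring
      _ ≤ K * x * (2 * Real.log x) := by
          refine mul_le_mul_of_nonneg_left ?_ (by positivity)
          calc ∑ a ∈ Ioc 0 A₀, (a : ℝ)⁻¹ ≤ 1 + Real.log A₀ := sum_Ioc_inv_le_one_add_log A₀
            _ ≤ 1 + Real.log x := by
                gcongr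
                exact hA₀le.trans h34x
            _ ≤ 2 * Real.log x := by linarith
      _ = 2 * C * 4 ^ (A + 1) * x / Real.log x ^ A := by
          rw [hKdef, hLA1]
          field_simp
  -- Part 2: `a > A₀`
  have hterm2 : ∀ a ∈ Ioc A₀ N,
      |(if IsSquare a then (1 : ℝ) else 0) * ∑ m ∈ Ioc 0 (N / a), (μ m : ℝ)| ≤
        x ^ (1 / 4 : ℝ) * (if IsSquare a then (1 : ℝ) else 0) := by
    intro a ha
    obtain ⟨haA, haN⟩ := mem_Ioc.mp ha
    have ha0' : (0 : ℝ) < a := by exact_mod_cast (lt_of_le_of_lt (Nat.zero_le _) haA)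
    have hxa : x ^ (3 / 4 : ℝ) ≤ a := by
      have h1 : x ^ (3 / 4 : ℝ) < (A₀ : ℝ) + 1 := Nat.lt_floor_add_one _
      have h2 : (A₀ : ℝ) + 1 ≤ a := by exact_mod_cast haA
      linarith
    have hNa : ((N / a : ℕ) : ℝ) ≤ x ^ (1 / 4 : ℝ) :=
      calc ((N / a : ℕ) : ℝ) ≤ (N : ℝ) / a := Nat.cast_div_le
        _ ≤ x / a := by gcongr
        _ ≤ x / x ^ (3 / 4 : ℝ) :=
            div_le_div_of_nonneg_left hx0.le (Real.rpow_pos_of_pos hx0 _) hxa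
        _ = x ^ (1 / 4 : ℝ) := hq14
    calc |(if IsSquare a then (1 : ℝ) else 0) * ∑ m ∈ Ioc 0 (N / a), (μ m : ℝ)|
        = (if IsSquare a then (1 : ℝ) else 0) * |∑ m ∈ Ioc 0 (N / a), (μ m : ℝ)| := by
          rw [abs_mul, abs_of_nonneg (hg0 a)]
      _ ≤ (if IsSquare a then (1 : ℝ) else 0) * ((N / a : ℕ) : ℝ) :=
          mul_le_mul_of_nonneg_left (abs_sum_moebius_le _) (hg0 a)
      _ ≤ (if IsSquare a then (1 : ℝ) else 0) * x ^ (1 / 4 : ℝ) :=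
          mul_le_mul_of_nonneg_left hNa (hg0 a)
      _ = x ^ (1 / 4 : ℝ) * (if IsSquare a then (1 : ℝ) else 0) := mul_comm _ _
  have h2 : |∑ a ∈ Ioc A₀ N, (if IsSquare a then (1 : ℝ) else 0) * ∑ m ∈ Ioc 0 (N / a), (μ m : ℝ)| ≤
      x / Real.log x ^ A := by
    calc |∑ a ∈ Ioc A₀ N, (if IsSquare a then (1 : ℝ) else 0) * ∑ m ∈ Ioc 0 (N / a), (μ m : ℝ)|
        ≤ ∑ a ∈ Ioc A₀ N, |(if IsSquare a then (1 : ℝ) else 0) * ∑ m ∈ Ioc 0 (N / a), (μ m : ℝ)| :=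
          abs_sum_le_sum_abs _ _
      _ ≤ ∑ a ∈ Ioc A₀ N, x ^ (1 / 4 : ℝ) * (if IsSquare a then (1 : ℝ) else 0) :=
          sum_le_sum hterm2
      _ = x ^ (1 / 4 : ℝ) * ∑ a ∈ Ioc A₀ N, (if IsSquare a then (1 : ℝ) else 0) := by
          rw [mul_sum]
      _ ≤ x ^ (1 / 4 : ℝ) * ∑ a ∈ Ioc 0 N, (if IsSquare a then (1 : ℝ) else 0) := by
          refine mul_le_mul_of_nonneg_left ?_ (Real.rpow_nonneg hx0.le _)
          exact sum_le_sum_of_subset_of_nonneg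
            (Ioc_subset_Ioc_left (Nat.zero_le _)) fun a _ _ => hg0 a
      _ ≤ x ^ (1 / 4 : ℝ) * Real.sqrt N :=
          mul_le_mul_of_nonneg_left (sum_Ioc_ite_isSquare_le N) (Real.rpow_nonneg hx0.le _)
      _ ≤ x ^ (1 / 4 : ℝ) * Real.sqrt x := by gcongr
      _ = x ^ (3 / 4 : ℝ) := hsqrt
      _ = x / x ^ (1 / 4 : ℝ) := hq34.symm
      _ ≤ x / Real.log x ^ A := div_le_div_of_nonneg_left hx0.le hLA hlog
  -- conclusion
  calc |∑ a ∈ Ioc 0 A₀, (if IsSquare a then (1 : ℝ) else 0) * ∑ m ∈ Ioc 0 (N / a), (μ m : ℝ)| +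
        |∑ a ∈ Ioc A₀ N, (if IsSquare a then (1 : ℝ) else 0) * ∑ m ∈ Ioc 0 (N / a), (μ m : ℝ)|
      ≤ 2 * C * 4 ^ (A + 1) * x / Real.log x ^ A + x / Real.log x ^ A := add_le_add h1 h2
    _ = (2 * C * 4 ^ (A + 1) + 1) * x / Real.log x ^ A := by ring

end LiouvilleSum

/-- **The prime number theorem for the Liouville function, every power of `log`.** For every
real `A` there is `C_A` with `|∑_{n ≤ x} λ(n)| ≤ C_A x/(log x)^A` for all `x ≥ 2`
(Montgomery–Vaughan §6.2.1 Exercise 11 (b): `∑_{n ≤ x} λ(n) ≪ x exp(−c√log x)`, a fortiori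
every power of `log`; PROVED along Exercise 11 (c) from the tree's Möbius bound (6.17) via
`λ = 𝟙_□ ⋆ μ`). [cite: MontgomeryVaughan2007, §6.2.1 Exercise 11 (b)–(c)] -/
theorem abs_sum_liouville_le_logPow (A : ℝ) :
    ∃ C : ℝ, ∀ x : ℝ, 2 ≤ x →
      |∑ n ∈ Ioc 0 ⌊x⌋₊, (liouville n : ℝ)| ≤ C * x / Real.log x ^ A := by
  obtain ⟨C, hC⟩ := LiouvilleSum.abs_sum_liouville_le_eventually (le_max_right A 0)
  obtain ⟨X₀, hX₀⟩ := Filter.eventually_atTop.mp (hC.and (eventually_ge_atTop (3 : ℝ)))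
  refine LiouvilleSum.forall_two_le_of_forall_ge (C := max C 0) (X₀ := X₀)
    (fun x hx => (LiouvilleSum.abs_sum_liouville_le _).trans (Nat.floor_le (by linarith)))
    fun x hx => ?_
  obtain ⟨h1, hx3⟩ := hX₀ x hx
  have hx0 : 0 < x := by linarith
  have hL1 : 1 ≤ Real.log x := LiouvilleSum.one_le_log hx3
  have hLA : 0 < Real.log x ^ A := Real.rpow_pos_of_pos (by linarith) A
  have hpow : Real.log x ^ A ≤ Real.log x ^ max A 0 :=
    Real.rpow_le_rpow_of_exponent_le hL1 (le_max_left _ _)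
  calc |∑ n ∈ Ioc 0 ⌊x⌋₊, (liouville n : ℝ)| ≤ C * x / Real.log x ^ max A 0 := h1
    _ ≤ max C 0 * x / Real.log x ^ max A 0 := by
        gcongr
        exact le_max_left _ _
    _ ≤ max C 0 * x / Real.log x ^ A := by
        gcongr

end Literature.NumberTheory.LFunctions
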